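import Summits.QuantumFields.BalabanUV.T4Continuum.Support.DirichletScalarTowerBox

/-!
# T⁴ programme, spine node NE2 (U1a), sub-row Δ1 «NE2⁰-Dirichlet» × tier A⁰ — THE ZEROTH-ORDER BACKGROUND LAYER OVER A REGION, SCALAR
# CARRIERS: a bounded, two-spacing-consistent potential `W` compressed to the region obeys `PerturbationLaws` against the Ω-restricted
# scalar free tower, hence ON A BOX OF UNIT BLOCKS the unit-lattice covariances of `(Ω₀(−Δ + a′Π′ + t·W^{(k)})Ω₀)⁻¹` CONVERGE at the torus
# rate `L⁻¹` — the first Ω-restricted PERTURBED tower in the tree whose free-tower input is a theorem (no `hinj`-type binder)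

Twelfth generation of the NE2 prover lineage P1 of the cell `pub-balaban` (row NE2 owner), file 6 (owner item O12-f).  Gen 11's
`Support/DirichletZerothOrder` ran the zeroth-order tier over the VECTOR region tower MODULO the injected law `hinj`; this file is its
twin on the SCALAR carriers of `Support/DirichletScalarTower` ([B9] (3.24)'s `Ω₀Δ′_aΩ₀` at `U = 1`), where on box regions the injected law
is now a THEOREM (`Support/DirichletScalarTowerBox`, ⇐ road P2's `DirichletBoxTwoLevel.injected_le_box`):

 * §1 `diagS Ω₀ W k = diag(W^{(k)})_{ΩΩ}`; a diagonal never couples the region to its complement; King's 0-form planting intertwines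
   potentials EXACTLY (`JK0_mul_diagonal : J₀·diag W = diag(W ∘ par)·J₀`); `opNorm_diagonal_le'`.
 * §2 **`perturbationLaws_potential_dirichletScalar`**: for a potential family `W^{(k)}` on the scalar tower with the two DATA bounds
   `‖W^{(k)}(x)‖ ≤ α` and `‖W^{(k+1)}(y) − W^{(k)}(par y)‖ ≤ β/n_k` (displayed as binders, asserted by nobody — tier A's `BoundedBackground`
   shape on scalar sites): `PerturbationLaws (DsR Ω₀) (diagS Ω₀ W) (JsR Ω₀) (α·γ′⁻¹) (k ↦ γ′⁻¹·β·γ′⁻¹·L^{−k})` for EVERY region `Ω₀`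
   (`‖G′(Ω)‖ ≤ γ′⁻¹` in place of the torus `‖G′‖ ≤ γ′⁻¹`; (H-cons) through `diag W′·J − J·diag W = (diag W′ − diag(W ∘ par))·J` compressed).
 * §3 THE ENDS: **`towerLimitRate_dirichletScalar_potential_of_injected`** (any `Ω₀`, modulo `hinjS` with majorant `C₁θ^k`, rate `θ`) and
   **`towerLimitRate_dirichletScalar_box_potential (hL : 2 ≤ L) (hd) (ha′) (hS : IsCoordBox M S) (hα) (hβ) (hW) (hW′) (ht : ‖t‖·αγ′⁻¹ < 1)`**:
   `TowerLimitRate (QsR …) L^d (k ↦ (DsR … k + t·diagS … W k)⁻¹) (Cpert (αγ′⁻¹) (2d√(γ′⁻¹)) (Cbox d L a′) (γ′⁻¹βγ′⁻¹) 0 t) L⁻¹` — displayed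
   binders: `2 ≤ L`, `0 < d`, `0 < a′`, `IsCoordBox M S`, the two data bounds on `W`, the coupling disc; NOTHING ELSE.

HONEST FRAMING (T4-DAG p. 1).  `U = 1` scalar free tower + a ZEROTH-ORDER model background (a potential as DATA — the abelian-model level of
tier A, not Bałaban's `Δ_a(U)`); ONE region, ONE averaging scale; finite torus; linear layer; operator norm; constants ours ([folklore]); «not
in print; our proof»; NE2 (U1a) NOT proved; spine 0/9 unchanged; NOT infinite volume, NOT a mass gap, NOT the Clay problem, NOT summit
progress.  HONEST DEPENDENCY: continuum YM on T⁴ ⇐ BetaPertH ∧ nine spine estimates (0/9 proved); BetaPertH ⇐ (D1) ∧ (D4) ∧ CAP+tail; G-an2-4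
gates asym, D1 and NE2/3/4.  No `sorry`.
-/

noncomputable section

open scoped BigOperators ComplexConjugate Matrix Matrix.Norms.L2Operator
open Filter Topology

namespace Summit.QuantumFields.BalabanUV.T4Continuum.DirichletScalarTowerPotential

open Literature.MathematicalPhysics.QuantumFieldTheory.Balaban1983to89.B5Prop11Plancherel (Tor fine)
open Literature.MathematicalPhysics.QuantumFieldTheory.Balaban1983to89.B5G183RateUnitTower (lev lev_neZero)
open Summit.QuantumFields.BalabanUV.T4Continuum
open Summit.QuantumFields.BalabanUV.T4Continuum.CovariantAveragingTower (TowerLimitRate)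
open Summit.QuantumFields.BalabanUV.T4Continuum.BalabanAveragedTowerUnit (one_le_lev' cast_lev')
open Summit.QuantumFields.BalabanUV.T4Continuum.BalabanAveragedTowerModes (par)
open Summit.QuantumFields.BalabanUV.T4Continuum.BackgroundResolventTower
open Summit.QuantumFields.BalabanUV.T4Continuum.SubtypeCompression
open Summit.QuantumFields.BalabanUV.T4Continuum.ScalarBlockPlanting (Qavg0 JK0 star_Qavg0_apply)
open Summit.QuantumFields.BalabanUV.T4Continuum.ScalarPlantingDefect (J0pcT)
open Summit.QuantumFields.BalabanUV.T4Continuum.ScalarAveragedPropagator (gammaPs gammaPs_pos)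
open Summit.QuantumFields.BalabanUV.T4Continuum.PerturbationAlgebra (perturbationLaws_mono)
open Summit.QuantumFields.BalabanUV.T4Continuum.DirichletScalarTower
open Summit.QuantumFields.BalabanUV.T4Continuum.DirichletScalarTowerBox (injected_le_box_lev Cbox_nonneg
  towerLimitRate_dirichletScalar_box_perturbed)
open Summit.QuantumFields.BalabanUV.Beta.GAN24.DirichletBoxTrace (blockReg)
open Summit.QuantumFields.BalabanUV.Beta.GAN24.DirichletBoxTwoLevel (IsCoordBox Cbox)

variable {d : ℕ} (L : ℕ) [NeZero L] (M : Fin d → ℕ) [hM : ∀ μ, NeZero (M μ)] (a' : ℝ)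
variable (Ω₀ : Tor (fine (lev L 0) M) → Prop) [DecidablePred Ω₀]

/-! ## §1 Potentials on the scalar tower, compressed to the region -/

/-- the potential `diag(W^{(k)})` restricted to the region. [folklore] -/
def diagS (W : (k : ℕ) → (Tor (fine (lev L k) M) → ℂ)) (k : ℕ) : Matrix (sidx L M Ω₀ k) (sidx L M Ω₀ k) ℂ :=
  (Matrix.diagonal (W k)).toBlock (regS L M Ω₀ k) (regS L M Ω₀ k)

omit [NeZero L] hM [DecidablePred Ω₀] in
/-- a diagonal never couples the region to its complement (either way). [folklore] -/
theorem diagonal_vanish {k : ℕ} (V : Tor (fine (lev L k) M) → ℂ) :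
    ∀ (i j : Tor (fine (lev L k) M)), regS L M Ω₀ k i → ¬ regS L M Ω₀ k j → Matrix.diagonal V i j = 0 := by
  intro i j hi hj
  have hne : i ≠ j := fun h => hj (h ▸ hi)
  rw [Matrix.diagonal_apply_ne _ hne]

omit [NeZero L] hM [DecidablePred Ω₀] in
/-- … (the other way). [folklore] -/
theorem diagonal_vanish' {k : ℕ} (V : Tor (fine (lev L k) M) → ℂ) :
    ∀ (i j : Tor (fine (lev L k) M)), ¬ regS L M Ω₀ k i → regS L M Ω₀ k j → Matrix.diagonal V i j = 0 := by
  intro i j hi hj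
  have hne : i ≠ j := fun h => hi (h ▸ hj)
  rw [Matrix.diagonal_apply_ne _ hne]

/-- `‖diag V‖ ≤ α` from pointwise bounds (any finite index type). [folklore] -/
theorem opNorm_diagonal_le' {m : Type*} [Fintype m] [DecidableEq m] {V : m → ℂ} {α : ℝ} (hα : 0 ≤ α) (hV : ∀ i, ‖V i‖ ≤ α) :
    ‖Matrix.diagonal V‖ ≤ α := by
  rw [Matrix.l2_opNorm_diagonal]
  exact (pi_norm_le_iff_of_nonneg hα).mpr hV

/-- **`J₀·diag V = diag(V ∘ par)·J₀`** for King's 0-form planting: multiplying a coarse field by `V` and planting is planting and multiplying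
by `V ∘ par`. [folklore] -/
theorem JK0_mul_diagonal {N R : ℕ} [NeZero N] [NeZero R] (V : Tor (fine N M) → ℂ) :
    JK0 N R M * Matrix.diagonal V = Matrix.diagonal (V ∘ par N R M) * JK0 N R M := by
  ext x y
  rw [Matrix.mul_diagonal, Matrix.diagonal_mul, Function.comp_apply]
  by_cases h : par N R M x = y
  · rw [h]; ring
  · have h0 : JK0 N R M x y = 0 := by
      rw [JK0, Matrix.smul_apply, Matrix.conjTranspose_apply, star_Qavg0_apply, Qavg0, if_neg h, smul_zero]
    rw [h0]; ring

/-! ## §2 Zeroth-order perturbations compressed to the region obey `PerturbationLaws` -/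

/-- **`PerturbationLaws` AT ZEROTH ORDER OVER THE REGION, SCALAR CARRIERS** (`a′ > 0`, any region `Ω₀`): a potential family with
`‖W^{(k)}(x)‖ ≤ α` and `‖W^{(k+1)}(y) − W^{(k)}(par y)‖ ≤ β/n_k` (DATA bounds) gives
`PerturbationLaws (DsR Ω₀) (diagS Ω₀ W) (JsR Ω₀) (α·γ′⁻¹) (k ↦ γ′⁻¹·β·γ′⁻¹·L^{−k})` — the torus proof of
`PerturbationAlgebra.perturbationLaws_zerothOrder` with `‖G′(Ω)‖ ≤ γ′⁻¹` in place of `‖𝒢‖ ≤ Cst`. [folklore] -/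
theorem perturbationLaws_potential_dirichletScalar (ha' : 0 < a') {W : (k : ℕ) → (Tor (fine (lev L k) M) → ℂ)} {α β : ℝ}
    (hα : 0 ≤ α) (hβ : 0 ≤ β) (hW : ∀ k x, ‖W k x‖ ≤ α)
    (hW' : ∀ k (y : Tor (fine (lev L (k + 1)) M)), ‖W (k + 1) y - W k (par (lev L k) L M y)‖ ≤ β / (lev L k : ℕ)) :
    PerturbationLaws (DsR L M a' Ω₀) (diagS L M Ω₀ W) (JsR L M Ω₀) (α * (gammaPs d a')⁻¹)
      (fun k => (gammaPs d a')⁻¹ * β * (gammaPs d a')⁻¹ * ((L : ℝ)⁻¹) ^ k) where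
  opNorm_P_mul_inv_le := fun k =>
    (Matrix.l2_opNorm_mul _ _).trans (mul_le_mul ((opNorm_toBlock_le _ _ _).trans (opNorm_diagonal_le' hα (hW k)))
      (opNorm_inv_DsR_le L M a' Ω₀ ha' k) (norm_nonneg _) hα)
  opNorm_inv_mul_P_le := fun k => by
    rw [mul_comm α]
    exact (Matrix.l2_opNorm_mul _ _).trans (mul_le_mul (opNorm_inv_DsR_le L M a' Ω₀ ha' k)
      ((opNorm_toBlock_le _ _ _).trans (opNorm_diagonal_le' hα (hW k))) (norm_nonneg _)
      (inv_nonneg.mpr (gammaPs_pos (d := d) (a' := a')).1.le))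
  consistent_le := fun k => by
    have hlev : (0 : ℝ) < (lev L k : ℕ) := by exact_mod_cast one_le_lev' L k
    have hγ : 0 ≤ (gammaPs d a')⁻¹ := inv_nonneg.mpr (gammaPs_pos (d := d) (a' := a')).1.le
    set p' := regS L M Ω₀ (k + 1)
    set p := regS L M Ω₀ k
    -- the compressed commutator is the compressed torus commutator
    set Dg : Matrix (Tor (fine (lev L (k + 1)) M)) (Tor (fine (lev L (k + 1)) M)) ℂ :=
      Matrix.diagonal (W (k + 1)) - Matrix.diagonal (fun i : Tor (fine (lev L (k + 1)) M) => W k (par (lev L k) L M i)) with hDg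
    have e : diagS L M Ω₀ W (k + 1) * JsR L M Ω₀ k - JsR L M Ω₀ k * diagS L M Ω₀ W k = Dg.toBlock p' p' * JsR L M Ω₀ k := by
      have h1 : diagS L M Ω₀ W (k + 1) * JsR L M Ω₀ k = (Matrix.diagonal (W (k + 1)) * J0pcT L M k).toBlock p' p := by
        rw [JsR_eq]; exact (toBlock_mul_of_vanish_left _ _ _ _ _ (diagonal_vanish L M Ω₀ (W (k + 1)))).symm
      have h2 : JsR L M Ω₀ k * diagS L M Ω₀ W k = (J0pcT L M k * Matrix.diagonal (W k)).toBlock p' p := by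
        rw [JsR_eq]; exact (toBlock_mul_of_vanish_right _ _ _ _ _ (diagonal_vanish' L M Ω₀ (W k))).symm
      have h3 : J0pcT L M k * Matrix.diagonal (W k)
          = Matrix.diagonal (fun i : Tor (fine (lev L (k + 1)) M) => W k (par (lev L k) L M i)) * J0pcT L M k :=
        JK0_mul_diagonal M (W k)
      have h4 : Dg.toBlock p' p' * JsR L M Ω₀ k = (Dg * J0pcT L M k).toBlock p' p := by
        rw [JsR_eq, hDg]
        refine (toBlock_mul_of_vanish_left _ _ _ _ _ fun i j hi hj => ?_).symm
        have hne : i ≠ j := fun h => hj (h ▸ hi)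
        rw [Matrix.sub_apply, Matrix.diagonal_apply_ne _ hne, Matrix.diagonal_apply_ne _ hne, sub_zero]
      rw [h1, h2, h3, h4, ← toBlock_sub, hDg, Matrix.sub_mul]
    have hdiff : ‖Dg.toBlock p' p'‖ ≤ β / (lev L k : ℕ) := by
      refine (opNorm_toBlock_le _ _ _).trans ?_
      rw [hDg, Matrix.diagonal_sub]
      exact opNorm_diagonal_le' (div_nonneg hβ hlev.le) fun i => hW' k i
    rw [e, ← Matrix.mul_assoc]
    calc _ ≤ ‖(DsR L M a' Ω₀ (k + 1))⁻¹ * Dg.toBlock p' p' * JsR L M Ω₀ k‖ * ‖(DsR L M a' Ω₀ k)⁻¹‖ := Matrix.l2_opNorm_mul _ _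
      _ ≤ ‖(DsR L M a' Ω₀ (k + 1))⁻¹ * Dg.toBlock p' p'‖ * ‖JsR L M Ω₀ k‖ * ‖(DsR L M a' Ω₀ k)⁻¹‖ :=
          mul_le_mul_of_nonneg_right (Matrix.l2_opNorm_mul _ _) (norm_nonneg _)
      _ ≤ ((gammaPs d a')⁻¹ * (β / (lev L k : ℕ))) * 1 * (gammaPs d a')⁻¹ := by
          have h0 : 0 ≤ (gammaPs d a')⁻¹ * (β / (lev L k : ℕ)) := mul_nonneg hγ (div_nonneg hβ hlev.le)
          refine mul_le_mul (mul_le_mul ((Matrix.l2_opNorm_mul _ _).trans (mul_le_mul (opNorm_inv_DsR_le L M a' Ω₀ ha' (k + 1))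
            hdiff (norm_nonneg _) hγ)) (opNorm_JsR_le L M Ω₀ k) (norm_nonneg _) h0) (opNorm_inv_DsR_le L M a' Ω₀ ha' k)
            (norm_nonneg _) (mul_nonneg h0 zero_le_one)
      _ = (gammaPs d a')⁻¹ * β * (gammaPs d a')⁻¹ * ((L : ℝ)⁻¹) ^ k := by rw [cast_lev', inv_pow]; ring

/-! ## §3 The ENDs: the zeroth-order tier over a region (modulo `hinjS`) and over a box (no free-tower binder) -/

/-- **THE ZEROTH-ORDER TIER OVER A REGION, MODULO `hinjS`** (`L⁻¹ ≤ θ < 1`, `d ≥ 1`, `a′ > 0`): potential data bounds + the injected law of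
the scalar Dirichlet tower with majorant `C₁θ^k` + a coupling `‖t‖·αγ′⁻¹ < 1` ⟹ the Ω-restricted unit-lattice covariances of
`(Δ′^{(k)})_{ΩΩ} + t·diag(W^{(k)})_{ΩΩ}` converge at rate `θ` with the displayed constant. [folklore] -/
theorem towerLimitRate_dirichletScalar_potential_of_injected (hd : 0 < d) (ha' : 0 < a') {θ C₁ : ℝ} (hθ : ((L : ℝ)⁻¹) ≤ θ)
    (hθ1 : θ < 1)
    (hinjS : ∀ k, ‖(DsR L M a' Ω₀ (k + 1))⁻¹ * JsR L M Ω₀ k - JsR L M Ω₀ k * (DsR L M a' Ω₀ k)⁻¹‖ ≤ C₁ * θ ^ k)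
    {W : (k : ℕ) → (Tor (fine (lev L k) M) → ℂ)} {α β : ℝ} (hα : 0 ≤ α) (hβ : 0 ≤ β) (hW : ∀ k x, ‖W k x‖ ≤ α)
    (hW' : ∀ k (y : Tor (fine (lev L (k + 1)) M)), ‖W (k + 1) y - W k (par (lev L k) L M y)‖ ≤ β / (lev L k : ℕ))
    {t : ℂ} (ht : ‖t‖ * (α * (gammaPs d a')⁻¹) < 1) :
    TowerLimitRate (QsR L M Ω₀) ((L : ℝ) ^ d) (fun k => (DsR L M a' Ω₀ k + t • diagS L M Ω₀ W k)⁻¹)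
      (Cpert (α * (gammaPs d a')⁻¹) (2 * d * Real.sqrt ((gammaPs d a')⁻¹)) C₁
        ((gammaPs d a')⁻¹ * β * (gammaPs d a')⁻¹) 0 t) θ := by
  have hγ : 0 ≤ (gammaPs d a')⁻¹ := inv_nonneg.mpr (gammaPs_pos (d := d) (a' := a')).1.le
  have hC₂ : 0 ≤ (gammaPs d a')⁻¹ * β * (gammaPs d a')⁻¹ := mul_nonneg (mul_nonneg hγ hβ) hγ
  have hpert := perturbationLaws_mono (perturbationLaws_potential_dirichletScalar L M a' Ω₀ ha' hα hβ hW hW') le_rfl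
    (fun k => mul_le_mul_of_nonneg_left (pow_le_pow_left₀ (inv_nonneg.mpr (Nat.cast_nonneg L)) hθ k) hC₂)
  exact towerLimitRate_dirichletScalar_perturbed L M a' Ω₀ hd ha' hθ hθ1 hinjS hpert ht

variable (S : Tor M → Prop) [DecidablePred S]

/-- **THE ZEROTH-ORDER TIER OVER A BOX — NO FREE-TOWER BINDER** (`L ≥ 2`, `d ≥ 1`, `a′ > 0`, `S` a coordinate box of unit blocks): for a
potential family `W` with `‖W^{(k)}(x)‖ ≤ α`, `‖W^{(k+1)}(y) − W^{(k)}(par y)‖ ≤ β/n_k` and a coupling `‖t‖·αγ′⁻¹ < 1`, the unit-lattice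
covariances of `(Ω₀(−Δ + a′Π′)Ω₀ + t·diag(W^{(k)})_{ΩΩ})⁻¹` on the block region of `S` CONVERGE as η = L^{−k} → 0 at the torus rate `L⁻¹`,
constant `Cpert (αγ′⁻¹) (2d√(γ′⁻¹)) (Cbox d L a′) (γ′⁻¹βγ′⁻¹) 0 t` — displayed binders: `2 ≤ L`, `0 < d`, `0 < a′`, `IsCoordBox M S`, the two
data bounds on `W`, the coupling disc, NOTHING ELSE. [folklore] -/
theorem towerLimitRate_dirichletScalar_box_potential (hL : 2 ≤ L) (hd : 0 < d) (ha' : 0 < a') (hS : IsCoordBox M S)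
    {W : (k : ℕ) → (Tor (fine (lev L k) M) → ℂ)} {α β : ℝ} (hα : 0 ≤ α) (hβ : 0 ≤ β) (hW : ∀ k x, ‖W k x‖ ≤ α)
    (hW' : ∀ k (y : Tor (fine (lev L (k + 1)) M)), ‖W (k + 1) y - W k (par (lev L k) L M y)‖ ≤ β / (lev L k : ℕ))
    {t : ℂ} (ht : ‖t‖ * (α * (gammaPs d a')⁻¹) < 1) :
    TowerLimitRate (QsR L M (blockReg (lev L 0) M S)) ((L : ℝ) ^ d)
      (fun k => (DsR L M a' (blockReg (lev L 0) M S) k + t • diagS L M (blockReg (lev L 0) M S) W k)⁻¹)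
      (Cpert (α * (gammaPs d a')⁻¹) (2 * d * Real.sqrt ((gammaPs d a')⁻¹)) (Cbox d L a')
        ((gammaPs d a')⁻¹ * β * (gammaPs d a')⁻¹) 0 t) ((L : ℝ)⁻¹) :=
  towerLimitRate_dirichletScalar_box_perturbed L M a' S hL hd ha' hS
    (perturbationLaws_potential_dirichletScalar L M a' (blockReg (lev L 0) M S) ha' hα hβ hW hW') ht

end Summit.QuantumFields.BalabanUV.T4Continuum.DirichletScalarTowerPotential

end
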